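import Mathlib

/-!
# Zeros of the twisted difference map off the diagonal (step T2a)

Crux `WitnessCharge` (stmt-SmoothPoincare4-7824), route `SullivanDual`, line Sketch. For a map
`h : ℂ → F` into a real normed space carrying a field of complex structures `J`, the twisted
difference map is
`T (z, w) = (‖z - w‖ ^ 2)⁻¹ • (Re (z - w) • (h z - h w) - Im (z - w) • J (h w) (h z - h w))`
off the diagonal and `dh_w 1` on it. This file shows that at an off-diagonal point `(z, w)` with
`J (h w) ∘ J (h w) = -1` the map `T` vanishes exactly when `h z = h w` (a double point).

Proof: with `a := Re (z - w)`, `b := Im (z - w)`, `Δ := h z - h w` and `J₀ := J (h w)`, the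
scalar prefactor `(‖z - w‖ ^ 2)⁻¹` is non-zero, and `a • Δ - b • J₀ Δ = 0` gives, after applying
`J₀` and using `J₀² = -1`, the identity `(a ^ 2 + b ^ 2) • Δ = 0`; since
`a ^ 2 + b ^ 2 = ‖z - w‖ ^ 2 ≠ 0`, `Δ = 0`. The converse is immediate.

Mathlib only; no definitions, no `sorry`.
-/

noncomputable section

-- the summit path `SmoothPoincare4/SmoothPoincare4` forces a duplicated namespace segment
set_option linter.dupNamespace false

namespace Summit.SmoothPoincare4.SmoothPoincare4.Theorems.WitnessCharge.PencilIncompleteness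

/-- **T2a — zeros of the twisted difference map off the diagonal are the double points.**
If `T` is the twisted difference map of `h` with respect to `J`, `z ≠ w`, and `J (h w)` squares to
`-1`, then `T (z, w) = 0 ↔ h z = h w`. -/
theorem helper_tdiff_eq_zero_iff :
    ∀ (F : Type) [NormedAddCommGroup F] [NormedSpace ℝ F] (J : F → F →L[ℝ] F)
      (h : ℂ → F) (T : ℂ × ℂ → F) (z w : ℂ),
      (∀ z w : ℂ, T (z, w) = if z = w then fderiv ℝ h w 1 else
        (‖z - w‖ ^ 2)⁻¹ • ((z - w).re • (h z - h w) - (z - w).im • J (h w) (h z - h w))) →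
      z ≠ w → (∀ v : F, J (h w) (J (h w) v) = -v) → (T (z, w) = 0 ↔ h z = h w) := by
  intro F _ _ J h T z w hT hzw hJ
  rw [hT z w, if_neg hzw]
  -- the scalar prefactor is non-zero
  have hn : ‖z - w‖ ^ 2 ≠ 0 := pow_ne_zero _ (norm_ne_zero_iff.mpr (sub_ne_zero.mpr hzw))
  rw [smul_eq_zero, or_iff_right (inv_ne_zero hn)]
  constructor
  · intro h0
    -- `a • Δ = b • J₀ Δ`
    have h1 : (z - w).re • (h z - h w) = (z - w).im • J (h w) (h z - h w) := sub_eq_zero.mp h0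
    -- applying `J₀`: `a • J₀ Δ = -(b • Δ)`
    have h2 : (z - w).re • J (h w) (h z - h w) = -((z - w).im • (h z - h w)) := by
      have h1' := congrArg (J (h w)) h1
      rw [(J (h w)).map_smul, (J (h w)).map_smul, hJ, smul_neg] at h1'
      exact h1'
    -- hence `(a ^ 2 + b ^ 2) • Δ = 0`
    have h3 : ((z - w).re ^ 2 + (z - w).im ^ 2) • (h z - h w) = 0 := by
      calc ((z - w).re ^ 2 + (z - w).im ^ 2) • (h z - h w)
          = (z - w).re • ((z - w).re • (h z - h w)) + (z - w).im • ((z - w).im • (h z - h w)) := by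
            rw [add_smul, pow_two, pow_two, mul_smul, mul_smul]
        _ = (z - w).re • ((z - w).im • J (h w) (h z - h w))
              + (z - w).im • ((z - w).im • (h z - h w)) := by rw [h1]
        _ = (z - w).im • ((z - w).re • J (h w) (h z - h w))
              + (z - w).im • ((z - w).im • (h z - h w)) := by rw [smul_comm]
        _ = (z - w).im • (-((z - w).im • (h z - h w)))
              + (z - w).im • ((z - w).im • (h z - h w)) := by rw [h2]
        _ = 0 := by rw [smul_neg, neg_add_cancel]
    -- and `a ^ 2 + b ^ 2 = ‖z - w‖ ^ 2 ≠ 0`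
    have hab : (z - w).re ^ 2 + (z - w).im ^ 2 ≠ 0 := by
      have hsq : (z - w).re ^ 2 + (z - w).im ^ 2 = ‖z - w‖ ^ 2 := by
        rw [Complex.sq_norm, Complex.normSq_apply]; ring
      rw [hsq]; exact hn
    exact sub_eq_zero.mp ((smul_eq_zero.mp h3).resolve_left hab)
  · intro hzw'
    rw [sub_eq_zero.mpr hzw', map_zero, smul_zero, smul_zero, sub_zero]

end Summit.SmoothPoincare4.SmoothPoincare4.Theorems.WitnessCharge.PencilIncompleteness
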